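import Summits.BirchSwinnertonDyer.BirchSwinnertonDyer.Theorems.SchneiderFreeAdditiveX3LeafOffSliver
import Summits.BirchSwinnertonDyer.BirchSwinnertonDyer.Theorems.SchneiderFreeAdditiveX3GoodMember
import Summits.BirchSwinnertonDyer.BirchSwinnertonDyer.Theorems.SchneiderFreeAdditiveX3GoodMemberStub
import HarnessLib

/-!
# Route `SchneiderFreeAdditiveX3` (rung K1 door): the (G-ord, `e = 2`) leaf residual with NAMED inputs
# only, bar the CH18 frame/value at `𝔭′` — the good member discharged by door-c4 gen 7 (modulo Ogg–Saito)

Cell `bsd-schneider-ideate`, seat `bsd-schneider-door-c5` (prover, generation 8); sequel to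
`…LeafOffSliver.lean` (p478396). HONEST FRAMING: an ASSEMBLY, CONDITIONAL on named facts (incl. the
PREPRINT claim `hKY` and the Ogg–Saito schema `hOS`) and on ONE explicit hypothesis that is NOT a fact
of the tree (`hCH`, Castella–Hsieh at the conjugate prime, untyped print); the crux `GordTwoBranchIMC`
(item 19177) is not restated and stays OPEN; closes no item by name; BSD is not advanced beyond this
typed reduction.

* `goodMemberHyp_of_oggSaito` — door-c4 gen 7's `GoodMember.exists_goodMember` (`…GoodMember.lean`: in
  the `p`-power `ℚ`-isogeny class of every curve of the cell and for every quadratic `K` with `p ∤ d_K`,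
  a globally minimal member in Keller–Yin's normalisation — `W₁(K)[p] = 0`, a rational `p`-line not
  fixed by `D_p`, Case (I), `Red`, `N_{W₁} = N` granted Ogg–Saito) packaged as the binder `hGM` of
  door-c3 gen 7's `gordTwoBranchIMC_of_facts_of_KY_OPEN` = skeleton v5's `stub_goodMember` signature
  (two primes above `p` ⟹ `p ∤ d_K`).
* `additiveX3RankOneLower_of_facts_of_KY_OPEN_of_oggSaito` — the rung leaf `AdditiveX3RankOneLower` ⇐
  `PrintedFacts` ∧ Poitou–Tate duality ∧ `PotMultBranchIMC` (cell (M)) ∧ {Gross 2004 §2, Gross 1991 §3,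
  Cai–Shu–Tian Thm. 1.1} ∧ `thm351_imc_isTorsion_mu_zero_charIdeal_eq_OPEN` (PRE) ∧ Ogg–Saito ∧ `hCH`.

References: [KellerYin2024b] arXiv:2410.23241 Thm. 3.5.1, Rem. 3.5.2, §3.3 ¶1; [SilvermanATAEC1994]
IV.10.2, IV.11.1 (Ogg–Saito); [CastellaHsieh2018] Thm. 5.7, Lemma 5.4; [JetchevSkinnerWan2017] §7.4.1.
-/

noncomputable section

open scoped Classical

open Field NumberField IsDedekindDomain WeierstrassCurve PowerSeries
open Literature.NumberTheory.EllipticCurves Literature.NumberTheory.EllipticCurves.GreenbergSelmer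
open Literature.NumberTheory.GaloisRepresentations
open Literature.NumberTheory.GaloisCohomology
open Literature.NumberTheory.EllipticCurves.ModularForms
  Literature.NumberTheory.EllipticCurves.CaiShuTian2014
  Literature.NumberTheory.EllipticCurves.KellerYin2024
  Literature.NumberTheory.EllipticCurves.Rank1Residual
  Literature.NumberTheory.EllipticCurves.Rank1Residual.Typed
  Summit.BirchSwinnertonDyer.Rank1Residual
  Summit.BirchSwinnertonDyer.Rank1Residual.X11b
  Summit.BirchSwinnertonDyer.Rank1Residual.X11b.AcSelmer
  Summit.BirchSwinnertonDyer.Rank1Residual.X11b.Halves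
  Summit.BirchSwinnertonDyer.BirchSwinnertonDyer.Theorems.SchneiderFree
  Summit.BirchSwinnertonDyer.BirchSwinnertonDyer.Theorems.SchneiderFreeControlAtoms

set_option linter.dupNamespace false
set_option autoImplicit false

namespace Summit.BirchSwinnertonDyer.BirchSwinnertonDyer.Theorems.SchneiderFreeAdditiveX3

/-! ## The good member DISCHARGED modulo Ogg–Saito (door-c4 gen 7's `exists_goodMember`) -/

section OggSaito

open Summit.BirchSwinnertonDyer.BirchSwinnertonDyer.Theses.SchneiderFreeAdditiveX3

/-- **`hGM` from Ogg–Saito.** Door-c4 gen 7's `GoodMember.exists_goodMember` (file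
`…GoodMember.lean`, p-power isogenous member in Keller–Yin's normalisation, degree `p^m · 1`, for
every quadratic `K` with `p ∤ d_K`) yields the good-member binder `hGM` of door-c3 gen 7's
`gordTwoBranchIMC_of_facts_of_KY_OPEN` / skeleton v5's `stub_goodMember` / `additiveX3RankOneLower_of_facts_of_KY_OPEN` VERBATIM, granted
the one named fact it uses, the Ogg–Saito comparison schema `hOS`
(`WeierstrassCurve.artinConductorExponent_tate_eq_conductorExponent_of_isElliptic`, for `N_{W₁} = N`):
`p` split in `K` (two primes above `p`) gives `p ∤ d_K`
(`X11b.Three.not_dvd_discr_of_ncard_primesOver_eq_two`). CONDITIONAL on `hOS`.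
[cite: SilvermanATAEC1994, Thm. IV.11.1 with IV.10.2 (Ogg–Saito; hypothesis)]
[cite: KellerYin2024b, §3.3 ¶1 and Rem. 3.5.2 (arXiv:2410.23241 p. 20)] -/
theorem goodMemberHyp_of_oggSaito
    (hOS : ∀ (W : WeierstrassCurve ℚ) (ℓ : ℕ) [Fact ℓ.Prime],
      W.artinConductorExponent_tate_eq_conductorExponent_of_isElliptic ℓ) :
    ∀ (W : WeierstrassCurve ℚ) [W.IsElliptic] [W.IsGloballyMinimal] (p : ℕ) [Fact p.Prime],
      p ≠ 2 → ClassX3 W p → Additive.SubGordTwo W p →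
      ∀ (K : Type) [Field K] [NumberField K], IsImaginaryQuadratic K →
      ((Ideal.span {(p : ℤ)}).primesOver (𝓞 K)).ncard = 2 →
      ∃ (W₁ : WeierstrassCurve ℚ) (_ : W₁.IsElliptic) (_ : W₁.IsGloballyMinimal)
        (φ : WeierstrassCurve.Isogeny W₁ W) (m d : ℕ),
        φ.degree = p ^ m * d ∧ ¬ p ∣ d ∧ W₁.conductorNorm ℤ = W.conductorNorm ℤ ∧
        W₁.HasGoodOrdinaryReductionOverQuadraticAt p ∧ Red W₁ p ∧
        (∃ Φ : AddSubgroup (geomTorsion W₁ (p : ℤ)),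
          IsRationalLine W₁ p Φ ∧ ¬ LineDecompositionTrivialAt W₁ p Φ) ∧
        ∀ Q : (W₁.baseChange K).toAffine.Point, p • Q = 0 → Q = 0 := by
  intro W _ _ p _ hp2 hX hS K _ _ hK hsplit
  obtain ⟨W₁, hE₁, hmin₁, φ, m, hdeg, hd, hN₁, hcase₁, hred₁, hlat₁, htf₁⟩ :=
    GoodMember.exists_goodMember hOS hp2 W hX hS K hK.1
      (X11b.Three.not_dvd_discr_of_ncard_primesOver_eq_two hK.1 hp2 hsplit)
  exact ⟨W₁, hE₁, hmin₁, φ, m, 1, hdeg, hd, hN₁, hcase₁, hred₁, hlat₁, htf₁⟩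

/-- **THE (G-ord, `e = 2`) LEAF RESIDUAL WITH NAMED INPUTS ONLY, bar the CH18 frame/value at `𝔭′`:** the
rung leaf `AdditiveX3RankOneLower` ⇐ `PrintedFacts` ∧ Poitou–Tate duality ∧ `PotMultBranchIMC` (for the
(M) cell) ∧ the three cite-only facts of the rebased road ∧ `hKY` (Keller–Yin Thm. 3.5.1, the littype's
typed claim, PREPRINT) ∧ Ogg–Saito (`hOS`, for the good member's conductor) ∧ `hCH` (CH18 §3 + Thm.
5.7 + Lemma 5.4 at the conjugate prime, print UNTYPED) — `…LeafOffSliver`'s `additiveX3RankOneLower_of_facts_of_KY_OPEN` with `hGM` discharged by door-c4 gen 7's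
`exists_goodMember`; NO sliver, NO good-member hypothesis. CONDITIONAL on all displayed inputs; closes
no item by name; BSD is not advanced beyond this typed reduction.
[cite: KellerYin2024b, Thm. 3.5.1 and Rem. 3.5.2 (arXiv:2410.23241 p. 20) (preprint; hypothesis)]
[cite: CastellaHsieh2018, Thm. 5.7 and Lemma 5.4 (arXiv:1505.08165 pp. 17–19) (shape of hCH; untyped)]
[cite: SilvermanATAEC1994, Thm. IV.11.1 (Ogg–Saito; hypothesis)]
[cite: JetchevSkinnerWan2017, §7.4.1 (arXiv:1512.06894 p. 30)] -/
theorem additiveX3RankOneLower_of_facts_of_KY_OPEN_of_oggSaito (hF : PrintedFacts)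
    (hPT : ∀ (K : Type) [Field K] [NumberField K], poitouTate_selmerStructure_duality K)
    (h2 : PotMultBranchIMC)
    (hG : Gross2004.rankinLSeries_eq_mul_quadraticTwist)
    (hRat : phi_heegnerPointOfConductor_mem_ringClassField)
    (hCST : thm11_ringClassChar)
    (hKY : thm351_imc_isTorsion_mu_zero_charIdeal_eq_OPEN)
    (hOS : ∀ (W : WeierstrassCurve ℚ) (ℓ : ℕ) [Fact ℓ.Prime],
      W.artinConductorExponent_tate_eq_conductorExponent_of_isElliptic ℓ)
    (hCH : ∀ (p : ℕ) [Fact p.Prime] (W' : WeierstrassCurve ℚ) [W'.IsElliptic] [W'.IsGloballyMinimal]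
      [NeZero (W'.conductorNorm ℤ)] (D C₂ : VariableChange ℚ) [(D • W').IsCharNeTwoNF]
      [(C₂ • (D • W').quadraticTwist ((-1 : ℚ) ^ (p / 2) * p)).IsElliptic]
      [(C₂ • (D • W').quadraticTwist ((-1 : ℚ) ^ (p / 2) * p)).IsGloballyMinimal]
      (N : ℕ) [NeZero N] (K : Type) [Field K] [NumberField K]
      (Dt : ModularParametrizationData (C₂ • (D • W').quadraticTwist ((-1 : ℚ) ^ (p / 2) * p)) N)
      (H : HeegnerDatum N (NumberField.discr K)) (ι : K →+* ℂ)
      (P : ((C₂ • (D • W').quadraticTwist ((-1 : ℚ) ^ (p / 2) * p)).baseChange K).toAffine.Point),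
      (C₂ • (D • W').quadraticTwist ((-1 : ℚ) ^ (p / 2) * p)).analyticRank = 1 →
      Additive.N10.Locus (C₂ • (D • W').quadraticTwist ((-1 : ℚ) ^ (p / 2) * p)) p →
      (C₂ • (D • W').quadraticTwist ((-1 : ℚ) ^ (p / 2) * p)).conductorNorm ℤ = N →
      IsImaginaryQuadratic K → Odd (NumberField.discr K) → ¬ p ∣ Units.torsionOrder K →
      SatisfiesHeegnerHypothesis N K →
      ((C₂ • (D • W').quadraticTwist ((-1 : ℚ) ^ (p / 2) * p)).quadraticTwist
        (NumberField.discr K : ℚ)).entireLFunction 1 ≠ 0 →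
      WeierstrassCurve.Affine.Point.map ι.toRatAlgHom P = heegnerPointComplex Dt H →
      ¬ IsOfFinAddOrder P → p ≠ 2 → GoodOrd W' p → NumberField.discr K ≠ -3 →
      ∀ (κ : ZpExtension K p), κ.IsAnticyclotomic →
      ∀ (γ : Field.absoluteGaloisGroup K) [Fact (κ.IsTopGenerator γ)]
        (𝔭 : HeightOneSpectrum (𝓞 K)) (h𝔭 : ((p : ℕ) : 𝓞 K) ∈ 𝔭.asIdeal)
        (he : 𝔭.asIdeal.ramificationIdx (𝓞 ℚ) = 1) (hf : 𝔭.asIdeal.inertiaDeg (𝓞 ℚ) = 1),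
      ∀ [NumberField (ringClassField K ι p)]
        (Dt' : ModularParametrizationData W' (W'.conductorNorm ℤ)),
      ∀ (𝔭' : HeightOneSpectrum (𝓞 K)) (h𝔭' : ((p : ℕ) : 𝓞 K) ∈ 𝔭'.asIdeal)
        (he' : 𝔭'.asIdeal.ramificationIdx (𝓞 ℚ) = 1) (hf' : 𝔭'.asIdeal.inertiaDeg (𝓞 ℚ) = 1),
      𝔭 ≠ 𝔭' → ∀ (ι' : PadicAlgCl p ≃+* ℂ), BranchInducesPrime p ι' 𝔭' →
      ∃ (ΩK : ℂ) (Ωp : ℂ_[p]) (L : UnrSeries p) (u : unrIntegers p),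
        ΩK ≠ 0 ∧ Ωp ≠ 0 ∧ IsBDPLFunction ι' 𝔭' κ γ Dt.f ΩK Ωp L ∧ ¬ C (p : unrIntegers p) ∣ L ∧
        ∀ (y : (W'.baseChange (ringClassField K ι p : Type)).toAffine.Point),
          WeierstrassCurve.Affine.Point.map (ringClassField K ι p).subtype.toRatAlgHom y =
            heegnerPointComplexOfConductor Dt' (NumberField.discr K) H.β p →
          ∀ (θ : ringClassField K ι p)
            (hθ2 : θ ^ 2 = algebraMap ℚ (ringClassField K ι p) ((-1 : ℚ) ^ (p / 2) * p))
            (hθ : θ ≠ 0) (s : ringClassGal ι p → ℤˣ),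
          (∀ σ : ringClassGal ι p, σ.1 θ = ((s σ : ℤ) : ringClassField K ι p) * θ) →
          ∀ Q : ((C₂ • (D • W').quadraticTwist ((-1 : ℚ) ^ (p / 2) * p)).baseChange K).toAffine.Point,
          Affine.Point.map (algebraMap K (ringClassField K ι p)).toRatAlgHom Q =
            VariableChange.pointEquivBaseChange ((D • W').quadraticTwist ((-1 : ℚ) ^ (p / 2) * p)) C₂
              (ringClassField K ι p)
              ((VariableChange.pointEquiv (((D • W').quadraticTwist
                  ((-1 : ℚ) ^ (p / 2) * p)).baseChange (ringClassField K ι p : Type))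
                  (untwistAt hθ)).symm
                ((Affine.Point.congrEquiv (untwistAt_smul_eq (D • W') hθ2 hθ)).symm
                  (VariableChange.pointEquivBaseChange W' D (ringClassField K ι p)
                    (∑ τ : ringClassGal ι p,
                      (s τ : ℤ) • pointGalHom W' (ringClassField K ι p : Type) τ.1 y)))) →
          L.HasValueAt 0 (((u : unrIntegers p) : ℂ_[p]) *
            (algebraMap ℚ_[p] ℂ_[p] (logOmega (C₂ • (D • W').quadraticTwist ((-1 : ℚ) ^ (p / 2) * p))
              p (embAt K p 𝔭' h𝔭' he' hf') Q / (Dt'.c : ℚ_[p]))) ^ 2)) :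
    Summit.BirchSwinnertonDyer.BirchSwinnertonDyer.Theorems.SchneiderFree.AdditiveX3RankOneLower :=
  additiveX3RankOneLower_of_facts_of_KY_OPEN hF hPT h2 hG hRat hCST hKY (goodMemberHyp_of_oggSaito hOS) hCH

end OggSaito

/-! ## (appended, door-c5 gen 8) Ogg–Saito REPLACED by modularity — door-c4 gen 7's `stub_goodMember_of_modularParametrization` -/

section Modular

open Summit.BirchSwinnertonDyer.BirchSwinnertonDyer.Theses.SchneiderFreeAdditiveX3

/-- **THE (G-ord, `e = 2`) LEAF RESIDUAL, final shape of this seat: the rung leaf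
`AdditiveX3RankOneLower` ⇐ `PrintedFacts` ∧ Poitou–Tate duality ∧ `PotMultBranchIMC` (cell (M)) ∧ the
three cite-only facts of the rebased road ∧ `hKY` (Keller–Yin Thm. 3.5.1, typed PREPRINT claim) ∧ `hCH`
(CH18 §3 + Thm. 5.7 + Lemma 5.4 at the conjugate prime, print UNTYPED)** — NO sliver, NO good-member
hypothesis, NO Ogg–Saito: the good member is door-c4 gen 7's
`GoodMember.stub_goodMember_of_modularParametrization` (`…GoodMemberStub.lean`), whose conductor clause is
paid by modularity (`nonempty_modularParametrizationData`, conjunct 5 of `PrintedFacts`). CONDITIONAL on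
all displayed inputs; closes no item by name; BSD is not advanced beyond this typed reduction.
[cite: KellerYin2024b, Thm. 3.5.1 and Rem. 3.5.2 (arXiv:2410.23241 p. 20) (preprint; hypothesis)]
[cite: CastellaHsieh2018, Thm. 5.7 and Lemma 5.4 (arXiv:1505.08165 pp. 17–19) (shape of hCH; untyped)]
[cite: JetchevSkinnerWan2017, §7.4.1 (arXiv:1512.06894 p. 30)] [cite: AtkinLehner1970, Thm. 4] -/
theorem additiveX3RankOneLower_of_facts_of_KY_OPEN_of_CH (hF : PrintedFacts)
    (hPT : ∀ (K : Type) [Field K] [NumberField K], poitouTate_selmerStructure_duality K)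
    (h2 : PotMultBranchIMC)
    (hG : Gross2004.rankinLSeries_eq_mul_quadraticTwist)
    (hRat : phi_heegnerPointOfConductor_mem_ringClassField)
    (hCST : thm11_ringClassChar)
    (hKY : thm351_imc_isTorsion_mu_zero_charIdeal_eq_OPEN)
    (hCH : ∀ (p : ℕ) [Fact p.Prime] (W' : WeierstrassCurve ℚ) [W'.IsElliptic] [W'.IsGloballyMinimal]
      [NeZero (W'.conductorNorm ℤ)] (D C₂ : VariableChange ℚ) [(D • W').IsCharNeTwoNF]
      [(C₂ • (D • W').quadraticTwist ((-1 : ℚ) ^ (p / 2) * p)).IsElliptic]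
      [(C₂ • (D • W').quadraticTwist ((-1 : ℚ) ^ (p / 2) * p)).IsGloballyMinimal]
      (N : ℕ) [NeZero N] (K : Type) [Field K] [NumberField K]
      (Dt : ModularParametrizationData (C₂ • (D • W').quadraticTwist ((-1 : ℚ) ^ (p / 2) * p)) N)
      (H : HeegnerDatum N (NumberField.discr K)) (ι : K →+* ℂ)
      (P : ((C₂ • (D • W').quadraticTwist ((-1 : ℚ) ^ (p / 2) * p)).baseChange K).toAffine.Point),
      (C₂ • (D • W').quadraticTwist ((-1 : ℚ) ^ (p / 2) * p)).analyticRank = 1 →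
      Additive.N10.Locus (C₂ • (D • W').quadraticTwist ((-1 : ℚ) ^ (p / 2) * p)) p →
      (C₂ • (D • W').quadraticTwist ((-1 : ℚ) ^ (p / 2) * p)).conductorNorm ℤ = N →
      IsImaginaryQuadratic K → Odd (NumberField.discr K) → ¬ p ∣ Units.torsionOrder K →
      SatisfiesHeegnerHypothesis N K →
      ((C₂ • (D • W').quadraticTwist ((-1 : ℚ) ^ (p / 2) * p)).quadraticTwist
        (NumberField.discr K : ℚ)).entireLFunction 1 ≠ 0 →
      WeierstrassCurve.Affine.Point.map ι.toRatAlgHom P = heegnerPointComplex Dt H →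
      ¬ IsOfFinAddOrder P → p ≠ 2 → GoodOrd W' p → NumberField.discr K ≠ -3 →
      ∀ (κ : ZpExtension K p), κ.IsAnticyclotomic →
      ∀ (γ : Field.absoluteGaloisGroup K) [Fact (κ.IsTopGenerator γ)]
        (𝔭 : HeightOneSpectrum (𝓞 K)) (h𝔭 : ((p : ℕ) : 𝓞 K) ∈ 𝔭.asIdeal)
        (he : 𝔭.asIdeal.ramificationIdx (𝓞 ℚ) = 1) (hf : 𝔭.asIdeal.inertiaDeg (𝓞 ℚ) = 1),
      ∀ [NumberField (ringClassField K ι p)]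
        (Dt' : ModularParametrizationData W' (W'.conductorNorm ℤ)),
      ∀ (𝔭' : HeightOneSpectrum (𝓞 K)) (h𝔭' : ((p : ℕ) : 𝓞 K) ∈ 𝔭'.asIdeal)
        (he' : 𝔭'.asIdeal.ramificationIdx (𝓞 ℚ) = 1) (hf' : 𝔭'.asIdeal.inertiaDeg (𝓞 ℚ) = 1),
      𝔭 ≠ 𝔭' → ∀ (ι' : PadicAlgCl p ≃+* ℂ), BranchInducesPrime p ι' 𝔭' →
      ∃ (ΩK : ℂ) (Ωp : ℂ_[p]) (L : UnrSeries p) (u : unrIntegers p),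
        ΩK ≠ 0 ∧ Ωp ≠ 0 ∧ IsBDPLFunction ι' 𝔭' κ γ Dt.f ΩK Ωp L ∧ ¬ C (p : unrIntegers p) ∣ L ∧
        ∀ (y : (W'.baseChange (ringClassField K ι p : Type)).toAffine.Point),
          WeierstrassCurve.Affine.Point.map (ringClassField K ι p).subtype.toRatAlgHom y =
            heegnerPointComplexOfConductor Dt' (NumberField.discr K) H.β p →
          ∀ (θ : ringClassField K ι p)
            (hθ2 : θ ^ 2 = algebraMap ℚ (ringClassField K ι p) ((-1 : ℚ) ^ (p / 2) * p))
            (hθ : θ ≠ 0) (s : ringClassGal ι p → ℤˣ),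
          (∀ σ : ringClassGal ι p, σ.1 θ = ((s σ : ℤ) : ringClassField K ι p) * θ) →
          ∀ Q : ((C₂ • (D • W').quadraticTwist ((-1 : ℚ) ^ (p / 2) * p)).baseChange K).toAffine.Point,
          Affine.Point.map (algebraMap K (ringClassField K ι p)).toRatAlgHom Q =
            VariableChange.pointEquivBaseChange ((D • W').quadraticTwist ((-1 : ℚ) ^ (p / 2) * p)) C₂
              (ringClassField K ι p)
              ((VariableChange.pointEquiv (((D • W').quadraticTwist
                  ((-1 : ℚ) ^ (p / 2) * p)).baseChange (ringClassField K ι p : Type))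
                  (untwistAt hθ)).symm
                ((Affine.Point.congrEquiv (untwistAt_smul_eq (D • W') hθ2 hθ)).symm
                  (VariableChange.pointEquivBaseChange W' D (ringClassField K ι p)
                    (∑ τ : ringClassGal ι p,
                      (s τ : ℤ) • pointGalHom W' (ringClassField K ι p : Type) τ.1 y)))) →
          L.HasValueAt 0 (((u : unrIntegers p) : ℂ_[p]) *
            (algebraMap ℚ_[p] ℂ_[p] (logOmega (C₂ • (D • W').quadraticTwist ((-1 : ℚ) ^ (p / 2) * p))
              p (embAt K p 𝔭' h𝔭' he' hf') Q / (Dt'.c : ℚ_[p]))) ^ 2)) :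
    Summit.BirchSwinnertonDyer.BirchSwinnertonDyer.Theorems.SchneiderFree.AdditiveX3RankOneLower :=
  additiveX3RankOneLower_of_facts_of_KY_OPEN hF hPT h2 hG hRat hCST hKY
    (GoodMember.stub_goodMember_of_modularParametrization hF.2.2.2.2.1) hCH

end Modular

end Summit.BirchSwinnertonDyer.BirchSwinnertonDyer.Theorems.SchneiderFreeAdditiveX3

end
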